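import Mathlib
import HarnessLib
import Summits.HubbardSuperconductivity.HubbardSuperconductivity.Theorems.KLProgrammeC4aSymInterpCharacter
import Summits.HubbardSuperconductivity.HubbardSuperconductivity.Theorems.KLProgrammeKLRegimeSplitTwoLegIncrementRepReading

/-!
# Route `KLProgramme` — crux C4a, the representation of the local part: EVERY localised two-leg reading is a CHARACTER POLYNOMIAL of the external
# lattice momentum, so `ν_n(K)(θ)` and its scale increment are — EXACTLY — the averages over the eight `D₄`-images of the angle of ONE smooth
# function, the continuum two-point kernel read at the frame's Fermi point

Cell `gate-hubbard-kl`, lane hubbard-kl-c4a-1 (g5); helper for stub (C) `stub_twoLeg_curvature` of the engine-flow child `KLRegimeEngineV17F2`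
(stmt-HubbardSuperconductivity-20437); memo HOME/hubbard-kl-c4a-1/C4A-PLAN.md §16.4–16.5 (LAYER-1 glue, steps (ii)–(iii)).  Continues
`…C4aSymInterpCharacter` (the interpolant is exact on character data; eight images along the Fermi curve):

* §1 `IsCharPoly L G` — `G : (Fin 2 → ℝ) → ℂ` is a CANONICAL character polynomial `P ↦ Σ_{z ∈ ℤ_L²} c_z·e^{iP·z̃}` (centred frequencies); closure under
  sums / constants / products by constants, the plane wave and the constants are ones; **`IsCharPoly.eq_of_eq_latticeMomentum`** (two canonical character
  polynomials that agree at every lattice momentum agree EVERYWHERE — character orthogonality); **`IsCharPoly.eval_symInterp_re_klFermiPoint`** (the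
  eight-image identity of `…C4aSymInterpCharacter` keyed by the predicate).
* §2 `selfEnergyCont β G q₀ σ P` (def) — the CONTINUUM two-point reading of a Grassmann element `G` at external momentum `P ∈ ℝ²`:
  `2βL²·|Λ|⁻²·Σ_x W₂(x)·e^{iω_{q₀}(t₀−t₁)}·e^{iP·(x⃗₀−x⃗₁)~}`; `selfEnergy_eq_selfEnergyCont` (at lattice momenta it IS the self-energy: Fourier inversion
  `kernel_eq_invCard_mul_sum_positionKernel` + the external pair `conj_hubbardPlaneWave_zero_mul_conj_hubbardPlaneWave_one`); it is a character polynomial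
  and linear in `G`; `localReadingCont β G P := ¼Σ_σ[selfEnergyCont(ω₀) + selfEnergyCont(−ω₀)]` and `klLocSelfEnergyRe`'s reading is its real part on the lattice.
* §3 **`eval_symInterp_localReading_klFermiPoint`** — for EVERY Grassmann element `G` and EVERY frame `K`:
  `I_L[¼Σ_σ Re(Σ_G(±ω₀,·,σ))](k_F^K(θ)) = ⅛ Σ_{θ′} Re localReadingCont G (k_F^K(θ′))`, `θ′` over `{θ, −θ, π/2−θ, π/2+θ} + {0, π}`; hence
  **`klLocalPart_eq_avg8`**: `ν_n(K)(θ) = ⅛ Σ_{θ′} Re localReadingCont (𝒱_n[K]) (k_F^K(θ′))` — exact, for all `n`, all frames, no symmetry of the kernels used.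
* §4 the scale increment: `localReadingCont_effAction_split` (input + one line + ≥ 2 self-lines + ≥ 2 vertices, by linearity) and
  **`klLocalPart_succ_sub_eq_avg8`**: `ν_{n+1}(K)(θ) − ν_n(K)(θ) = ⅛ Σ_{θ′} Re[localReadingCont(Δ_S 𝒱_n) + localReadingCont(R₁) + localReadingCont(R₂)](k_F^K(θ′))`
  (`Z^K_{Λ_n} ≠ 0`) — LAYER 1's `klLocalPart_succ_sub_eq` with the interpolant REMOVED: the three LAYER-2 inputs are now smooth functions of a continuum
  momentum read at eight Fermi points; `…C4aTadpoleRepresentation` identifies the first with the tube tadpole of `…C4aTubeTadpoleCert` up to aliasing.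

Exact identities and one definition family; nothing is asserted about the Hubbard model's sizes; nothing asserts superconductivity.
References: BGM 2006 §2.1 (2.3)–(2.5), §2.3 (2.17), §2.4 [cite: BenfattoGiulianiMastropietro2006]; Zygmund X §2 [cite: Zygmund2002].
-/

noncomputable section

namespace Summit.HubbardSuperconductivity.HubbardSuperconductivity.Theorems.C4a

set_option linter.dupNamespace false -- summit = problem name (single-conjunct summit), D-0017

open Real Finset Literature.MathematicalPhysics.QuantumLattice Literature.Probability.LatticeModels GrassmannAlgebra
open Summit.HubbardSuperconductivity.HubbardSuperconductivity.Theorems.KLRegimeSplit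
open Summit.HubbardSuperconductivity.HubbardSuperconductivity.Theorems.KLProgrammeLegKernels

/-! ## §1 Canonical character polynomials -/

section CharPoly

variable (L : ℕ) [NeZero L]

/-- **`IsCharPoly L G`** — `G` is a canonical character polynomial of the `L`-lattice: `G(P) = Σ_{z ∈ ℤ_L²} c_z·e^{i Σ_j P_j z̃_j}` with the CENTRED
frequencies `z̃ = valMinAbs z` (`2|z̃_j| ≤ L`).  Every momentum-space reading of a Grassmann element of the Hubbard torus at an external lattice momentum
is the lattice sample of one (§2). -/
def IsCharPoly (G : (Fin 2 → ℝ) → ℂ) : Prop :=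
  ∃ c : TorusSite 2 L → ℂ, ∀ P : Fin 2 → ℝ, G P = ∑ z : TorusSite 2 L, c z * Complex.exp (((∑ j, P j * ((z j).valMinAbs : ℝ) : ℝ) : ℂ) * Complex.I)

variable {L}

namespace IsCharPoly

variable {G G₁ G₂ : (Fin 2 → ℝ) → ℂ}

/-- A canonical character polynomial is a `charPoly` indexed by the sites. -/
theorem eq_charPoly (h : IsCharPoly L G) : ∃ c : TorusSite 2 L → ℂ, ∀ P, G P = charPoly Finset.univ c id P := by
  obtain ⟨c, hc⟩ := h
  exact ⟨c, fun P => by rw [hc P]; rfl⟩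

/-- Sums. -/
theorem add (h₁ : IsCharPoly L G₁) (h₂ : IsCharPoly L G₂) : IsCharPoly L fun P => G₁ P + G₂ P := by
  obtain ⟨c₁, hc₁⟩ := h₁
  obtain ⟨c₂, hc₂⟩ := h₂
  refine ⟨fun z => c₁ z + c₂ z, fun P => ?_⟩
  dsimp only
  rw [hc₁ P, hc₂ P, ← Finset.sum_add_distrib]
  exact Finset.sum_congr rfl fun z _ => by ring

/-- Left constants. -/
theorem const_mul (h : IsCharPoly L G) (a : ℂ) : IsCharPoly L fun P => a * G P := by
  obtain ⟨c, hc⟩ := h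
  refine ⟨fun z => a * c z, fun P => ?_⟩
  dsimp only
  rw [hc P, Finset.mul_sum]
  exact Finset.sum_congr rfl fun z _ => by ring

/-- Right constants. -/
theorem mul_const (h : IsCharPoly L G) (a : ℂ) : IsCharPoly L fun P => G P * a := by
  obtain ⟨c, hc⟩ := h
  refine ⟨fun z => c z * a, fun P => ?_⟩
  dsimp only
  rw [hc P, Finset.sum_mul]
  exact Finset.sum_congr rfl fun z _ => by ring

/-- Division by a constant. -/
theorem div_const (h : IsCharPoly L G) (a : ℂ) : IsCharPoly L fun P => G P / a := by
  simp_rw [div_eq_mul_inv]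
  exact h.mul_const _

/-- Differences. -/
theorem sub (h₁ : IsCharPoly L G₁) (h₂ : IsCharPoly L G₂) : IsCharPoly L fun P => G₁ P - G₂ P := by
  have h := h₁.add (h₂.const_mul (-1))
  simp_rw [neg_one_mul, ← sub_eq_add_neg] at h
  exact h

/-- Finite sums. -/
theorem sum {ι : Type*} (s : Finset ι) {F : ι → (Fin 2 → ℝ) → ℂ} (h : ∀ i, IsCharPoly L (F i)) : IsCharPoly L fun P => ∑ i ∈ s, F i P := by
  classical
  induction s using Finset.induction_on with
  | empty =>
    refine ⟨fun _ => 0, fun P => ?_⟩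
    simp
  | insert a s ha ih =>
    simp_rw [Finset.sum_insert ha]
    exact (h a).add ih

end IsCharPoly

/-- **A plane wave with a lattice frequency, times a constant, is one.** -/
theorem isCharPoly_const_mul_cexp (a : ℂ) (z : TorusSite 2 L) :
    IsCharPoly L fun P => a * Complex.exp (((∑ j, P j * ((z j).valMinAbs : ℝ) : ℝ) : ℂ) * Complex.I) := by
  classical
  refine ⟨fun w => if w = z then a else 0, fun P => ?_⟩
  simp_rw [ite_mul, zero_mul]
  rw [Finset.sum_ite_eq' Finset.univ z]
  simp

/-- Constants are ones (frequency `0`). -/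
theorem isCharPoly_const (a : ℂ) : IsCharPoly L fun _ => a := by
  have h := isCharPoly_const_mul_cexp (L := L) a 0
  simp only [Pi.zero_apply, ZMod.valMinAbs_zero, Int.cast_zero, mul_zero, Finset.sum_const_zero, Complex.ofReal_zero, zero_mul,
    Complex.exp_zero, mul_one] at h
  exact h

/-- The coefficients of a canonical character polynomial are determined by its lattice samples: `L²·c_w = Σ_k G(p_k)·χ_k(−w)`. -/
theorem IsCharPoly.coeff_eq {G : (Fin 2 → ℝ) → ℂ} {c : TorusSite 2 L → ℂ}
    (hc : ∀ P : Fin 2 → ℝ, G P = ∑ z : TorusSite 2 L, c z * Complex.exp (((∑ j, P j * ((z j).valMinAbs : ℝ) : ℝ) : ℂ) * Complex.I))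
    (w : TorusSite 2 L) : ((L : ℂ) ^ 2) * c w = ∑ k : TorusSite 2 L, G (latticeMomentum L k) * torusChar k (-w) := by
  classical
  have hk : ∀ k : TorusSite 2 L, G (latticeMomentum L k) = ∑ z : TorusSite 2 L, c z * torusChar k z := fun k => by
    rw [hc]
    exact Finset.sum_congr rfl fun z _ => by rw [torusChar_eq_cexp_valMinAbs]
  simp_rw [hk, Finset.sum_mul]
  rw [Finset.sum_comm]
  simp_rw [mul_assoc, ← Finset.mul_sum, sum_torusChar_mul_torusChar, neg_inj]
  rw [Finset.sum_eq_single w (fun z _ hz => by rw [if_neg (Ne.symm hz), mul_zero]) (fun h => absurd (Finset.mem_univ w) h), if_pos rfl, mul_comm]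

/-- **UNIQUENESS FROM THE LATTICE.**  Two canonical character polynomials of the `L`-lattice that agree at every lattice momentum agree at every
continuum momentum (each frequency `z̃` is the UNIQUE centred representative of its site, and the characters are orthogonal). [cite: Zygmund2002, Ch. X §2] -/
theorem IsCharPoly.eq_of_eq_latticeMomentum {G₁ G₂ : (Fin 2 → ℝ) → ℂ} (h₁ : IsCharPoly L G₁) (h₂ : IsCharPoly L G₂)
    (h : ∀ k : TorusSite 2 L, G₁ (latticeMomentum L k) = G₂ (latticeMomentum L k)) (P : Fin 2 → ℝ) : G₁ P = G₂ P := by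
  obtain ⟨c₁, hc₁⟩ := h₁
  obtain ⟨c₂, hc₂⟩ := h₂
  have hL : ((L : ℂ) ^ 2) ≠ 0 := pow_ne_zero _ (Nat.cast_ne_zero.2 (NeZero.ne L))
  have hcoef : ∀ w, c₁ w = c₂ w := fun w => by
    have e₁ := IsCharPoly.coeff_eq hc₁ w
    have e₂ := IsCharPoly.coeff_eq hc₂ w
    simp_rw [h] at e₁
    exact mul_left_cancel₀ hL (e₁.trans e₂.symm)
  rw [hc₁ P, hc₂ P]
  exact Finset.sum_congr rfl fun w _ => by rw [hcoef w]

/-- **THE EIGHT-IMAGE IDENTITY keyed by the predicate.**  For a canonical character polynomial `G` and ANY frame `K : TrigPolyC4v`: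
`(symInterp L (k⃗ ↦ Re G(p_k⃗))).eval (k_F^K(θ)) = ⅛ Σ_{θ′} Re G(k_F^K(θ′))`, `θ′ ∈ {θ, −θ, π/2−θ, π/2+θ} + {0, π}`. [cite: Zygmund2002, Ch. X §2] -/
theorem IsCharPoly.eval_symInterp_re_klFermiPoint {G : (Fin 2 → ℝ) → ℂ} (hG : IsCharPoly L G) (μ : ℝ) (K : TrigPolyC4v) (θ : ℝ) :
    (symInterp L (fun k => (G (latticeMomentum L k)).re)).eval (klFermiPoint μ K θ) =
      ((G (klFermiPoint μ K θ)).re + (G (klFermiPoint μ K (θ + π))).re +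
        ((G (klFermiPoint μ K (-θ))).re + (G (klFermiPoint μ K (-θ + π))).re) +
        ((G (klFermiPoint μ K (π / 2 - θ))).re + (G (klFermiPoint μ K (π / 2 - θ + π))).re) +
        ((G (klFermiPoint μ K (π / 2 + θ))).re + (G (klFermiPoint μ K (π / 2 + θ + π))).re)) / 8 := by
  obtain ⟨c, hc⟩ := hG.eq_charPoly
  simp_rw [hc]
  exact eval_symInterp_re_charPoly_klFermiPoint Finset.univ c id μ K θ

end CharPoly

/-! ## §2 The continuum two-point reading of a Grassmann element -/

section Model

variable {L M : ℕ} [NeZero L] [NeZero M]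

omit [NeZero M] in
/-- The position-space kernels are additive in the Grassmann element. -/
theorem positionKernel_add' (β : ℝ) (G₁ G₂ : HubbardGrassmann L M) (m : ℕ) (ξ : Fin m → (SpaceTimeIdx L M × Fin 2) × Fin 2) :
    positionKernel L M β (G₁ + G₂) m ξ = positionKernel L M β G₁ m ξ + positionKernel L M β G₂ m ξ := by
  simp only [positionKernel, kernel_add, mul_add, Finset.sum_add_distrib]

/-- **The continuum two-point reading** of a Grassmann element `G` at Matsubara label `q₀`, spin `σ` and external momentum `P ∈ ℝ²`:
`selfEnergyCont β G q₀ σ P = 2βL²·|Λ|⁻²·Σ_{x₀,x₁} W₂((x₀,σ,+),(x₁,σ,−))·e^{iω_{q₀}(t₀ − t₁)}·e^{i Σ_j P_j (x⃗₀ − x⃗₁)~_j}` — the self-energy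
`Σ_G((q₀, p⃗), σ)` with the lattice character `χ_{p⃗}(x⃗₀ − x⃗₁)` replaced by the plane wave at a continuum momentum (`selfEnergy_eq_selfEnergyCont`). -/
def selfEnergyCont (β : ℝ) (G : HubbardGrassmann L M) (q₀ : MatsubaraIdx M) (σ : Fin 2) (P : Fin 2 → ℝ) : ℂ :=
  ((((2 : ℕ).factorial : ℝ) * (β * (L : ℝ) ^ 2) ^ (2 - 1) : ℝ) : ℂ) *
    ((((Fintype.card (SpaceTimeIdx L M) : ℂ) ^ 2)⁻¹ *
      ∑ x : Fin 2 → SpaceTimeIdx L M, positionKernel L M β G 2 (fun i => ((x i, ![σ, σ] i), (![0, 1] : Fin 2 → Fin 2) i)) *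
        (Complex.exp (((matsubaraFreq β M q₀ * (imagTime β M (x 0).1 - imagTime β M (x 1).1) : ℝ) : ℂ) * Complex.I) *
          Complex.exp (((∑ j, P j * ((((x 0).2 - (x 1).2) j).valMinAbs : ℝ) : ℝ) : ℂ) * Complex.I))))

omit [NeZero L] [NeZero M] in
/-- The self-energy's leg string in coordinate form. -/
theorem selfEnergyLegs_eq (k : FreqMomentum L M) (σ : Fin 2) :
    (![((k, σ), 0), ((k, σ), 1)] : Fin 2 → HubbardFieldIdx L M) = fun i => ((![k, k] i, ![σ, σ] i), (![0, 1] : Fin 2 → Fin 2) i) := by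
  funext i
  fin_cases i <;> rfl

/-- **At a lattice momentum the continuum reading IS the self-energy**: `Σ_G((q₀, p⃗_k), σ) = selfEnergyCont β G q₀ σ (p_k⃗)` (`β ≠ 0`).
[cite: BenfattoGiulianiMastropietro2006, §2.3 (2.17)] -/
theorem selfEnergy_eq_selfEnergyCont {β : ℝ} (hβ : β ≠ 0) (G : HubbardGrassmann L M) (q₀ : MatsubaraIdx M) (k : TorusSite 2 L) (σ : Fin 2) :
    selfEnergy L M β G (q₀, k) σ = selfEnergyCont β G q₀ σ (latticeMomentum L k) := by
  unfold selfEnergy selfEnergyCont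
  rw [vertexFn_def, selfEnergyLegs_eq, kernel_eq_invCard_mul_sum_positionKernel hβ G 2]
  congr 2
  refine Finset.sum_congr rfl fun x _ => ?_
  congr 1
  rw [Fin.prod_univ_two]
  simp only [Matrix.cons_val_zero, Matrix.cons_val_one]
  rw [map_mul, conj_hubbardPlaneWave_zero_mul_conj_hubbardPlaneWave_one, torusChar_eq_cexp_valMinAbs]

omit [NeZero M] in
/-- The continuum reading is a canonical character polynomial of the external momentum. -/
theorem isCharPoly_selfEnergyCont (β : ℝ) (G : HubbardGrassmann L M) (q₀ : MatsubaraIdx M) (σ : Fin 2) :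
    IsCharPoly L (selfEnergyCont β G q₀ σ) := by
  unfold selfEnergyCont
  refine ((IsCharPoly.sum _ fun x => ?_).const_mul _).const_mul _
  simp_rw [← mul_assoc]
  exact isCharPoly_const_mul_cexp _ _

omit [NeZero M] in
/-- The continuum reading is additive in the Grassmann element. -/
theorem selfEnergyCont_add (β : ℝ) (G₁ G₂ : HubbardGrassmann L M) (q₀ : MatsubaraIdx M) (σ : Fin 2) (P : Fin 2 → ℝ) :
    selfEnergyCont β (G₁ + G₂) q₀ σ P = selfEnergyCont β G₁ q₀ σ P + selfEnergyCont β G₂ q₀ σ P := by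
  unfold selfEnergyCont
  rw [← mul_add, ← mul_add, ← Finset.sum_add_distrib]
  congr 2
  exact Finset.sum_congr rfl fun x _ => by rw [positionKernel_add', add_mul]

omit [NeZero M] in
/-- The continuum reading of a difference. -/
theorem selfEnergyCont_sub (β : ℝ) (G₁ G₂ : HubbardGrassmann L M) (q₀ : MatsubaraIdx M) (σ : Fin 2) (P : Fin 2 → ℝ) :
    selfEnergyCont β (G₁ - G₂) q₀ σ P = selfEnergyCont β G₁ q₀ σ P - selfEnergyCont β G₂ q₀ σ P := by
  rw [eq_sub_iff_add_eq, ← selfEnergyCont_add, sub_add_cancel]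

/-- **The continuum LOCALISED reading**: `localReadingCont β G P = ¼ Σ_σ [selfEnergyCont β G ω₀ σ P + selfEnergyCont β G (−ω₀) σ P]` — the complex
number whose real part, at a lattice momentum, is `klLocSelfEnergyRe`'s reading of `G`. -/
def localReadingCont (β : ℝ) (G : HubbardGrassmann L M) (P : Fin 2 → ℝ) : ℂ :=
  (∑ σ : Fin 2, (selfEnergyCont β G (omega0 M) σ P + selfEnergyCont β G (omega0 M).rev σ P)) / 4

/-- The localised reading is a canonical character polynomial. -/
theorem isCharPoly_localReadingCont (β : ℝ) (G : HubbardGrassmann L M) : IsCharPoly L (localReadingCont β G) := by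
  unfold localReadingCont
  exact (IsCharPoly.sum _ fun σ => (isCharPoly_selfEnergyCont β G _ σ).add (isCharPoly_selfEnergyCont β G _ σ)).div_const _

/-- The localised reading is additive in the Grassmann element. -/
theorem localReadingCont_add (β : ℝ) (G₁ G₂ : HubbardGrassmann L M) (P : Fin 2 → ℝ) :
    localReadingCont β (G₁ + G₂) P = localReadingCont β G₁ P + localReadingCont β G₂ P := by
  unfold localReadingCont
  rw [← add_div, ← Finset.sum_add_distrib]
  congr 1
  exact Finset.sum_congr rfl fun σ _ => by rw [selfEnergyCont_add, selfEnergyCont_add]; ring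

/-- The localised reading of a difference. -/
theorem localReadingCont_sub (β : ℝ) (G₁ G₂ : HubbardGrassmann L M) (P : Fin 2 → ℝ) :
    localReadingCont β (G₁ - G₂) P = localReadingCont β G₁ P - localReadingCont β G₂ P := by
  rw [eq_sub_iff_add_eq, ← localReadingCont_add, sub_add_cancel]

/-- **The lattice reading of `klLocSelfEnergyRe` is the real part of the continuum localised reading at the lattice momentum** (`β ≠ 0`). -/
theorem localReading_eq_re_localReadingCont {β : ℝ} (hβ : β ≠ 0) (G : HubbardGrassmann L M) (k : TorusSite 2 L) :
    (∑ σ : Fin 2, ((selfEnergy L M β G (omega0 M, k) σ).re + (selfEnergy L M β G ((omega0 M).rev, k) σ).re)) / 4 =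
      (localReadingCont β G (latticeMomentum L k)).re := by
  unfold localReadingCont
  rw [Complex.div_ofNat_re, Complex.re_sum]
  congr 1
  exact Finset.sum_congr rfl fun σ _ => by
    rw [Complex.add_re, selfEnergy_eq_selfEnergyCont hβ, selfEnergy_eq_selfEnergyCont hβ]

/-! ## §3 The eight-image identity for every localised reading; the local part `ν_n(K)` -/

/-- **EVERY LOCALISED TWO-LEG READING, INTERPOLATED AND READ ON THE FERMI CURVE, IS AN EIGHT-IMAGE AVERAGE** (`β ≠ 0`, any `G`, any frame `K`):
`I_L[¼Σ_σ(Re Σ_G(ω₀,·,σ) + Re Σ_G(−ω₀,·,σ))](k_F^K(θ)) = ⅛ Σ_{θ′} Re localReadingCont β G (k_F^K(θ′))`, `θ′ ∈ {θ, −θ, π/2−θ, π/2+θ} + {0, π}`.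
[cite: BenfattoGiulianiMastropietro2006, §2.4] -/
theorem eval_symInterp_localReading_klFermiPoint {β : ℝ} (hβ : β ≠ 0) (G : HubbardGrassmann L M) (μ : ℝ) (K : TrigPolyC4v) (θ : ℝ) :
    (symInterp L (fun k : TorusSite 2 L =>
        (∑ σ : Fin 2, ((selfEnergy L M β G (omega0 M, k) σ).re + (selfEnergy L M β G ((omega0 M).rev, k) σ).re)) / 4)).eval
        (klFermiPoint μ K θ) =
      ((localReadingCont β G (klFermiPoint μ K θ)).re + (localReadingCont β G (klFermiPoint μ K (θ + π))).re +
        ((localReadingCont β G (klFermiPoint μ K (-θ))).re + (localReadingCont β G (klFermiPoint μ K (-θ + π))).re) +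
        ((localReadingCont β G (klFermiPoint μ K (π / 2 - θ))).re + (localReadingCont β G (klFermiPoint μ K (π / 2 - θ + π))).re) +
        ((localReadingCont β G (klFermiPoint μ K (π / 2 + θ))).re + (localReadingCont β G (klFermiPoint μ K (π / 2 + θ + π))).re)) / 8 := by
  simp_rw [localReading_eq_re_localReadingCont hβ]
  exact (isCharPoly_localReadingCont β G).eval_symInterp_re_klFermiPoint μ K θ

/-- **THE LOCAL PART IS AN EIGHT-IMAGE AVERAGE** (`β ≠ 0`, every scale `n`, every frame `K`):
`ν_n(K)(θ) = ⅛ Σ_{θ′} Re localReadingCont β (𝒱_n[K]) (k_F^K(θ′))`. [cite: BenfattoGiulianiMastropietro2006, §2.4] -/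
theorem klLocalPart_eq_avg8 {β : ℝ} (hβ : β ≠ 0) (U μ : ℝ) (K : TrigPolyC4v) (n : ℕ) (θ : ℝ) :
    klLocalPart L M β U μ K n θ =
      ((localReadingCont β (klEffectiveAction L M β U μ K klE0 n) (klFermiPoint μ K θ)).re +
          (localReadingCont β (klEffectiveAction L M β U μ K klE0 n) (klFermiPoint μ K (θ + π))).re +
        ((localReadingCont β (klEffectiveAction L M β U μ K klE0 n) (klFermiPoint μ K (-θ))).re +
          (localReadingCont β (klEffectiveAction L M β U μ K klE0 n) (klFermiPoint μ K (-θ + π))).re) +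
        ((localReadingCont β (klEffectiveAction L M β U μ K klE0 n) (klFermiPoint μ K (π / 2 - θ))).re +
          (localReadingCont β (klEffectiveAction L M β U μ K klE0 n) (klFermiPoint μ K (π / 2 - θ + π))).re) +
        ((localReadingCont β (klEffectiveAction L M β U μ K klE0 n) (klFermiPoint μ K (π / 2 + θ))).re +
          (localReadingCont β (klEffectiveAction L M β U μ K klE0 n) (klFermiPoint μ K (π / 2 + θ + π))).re)) / 8 := by
  unfold klLocalPart
  have hdata : klLocSelfEnergyRe L M β U μ K n = fun k : TorusSite 2 L =>
      (∑ σ : Fin 2, ((selfEnergy L M β (klEffectiveAction L M β U μ K klE0 n) (omega0 M, k) σ).re +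
        (selfEnergy L M β (klEffectiveAction L M β U μ K klE0 n) ((omega0 M).rev, k) σ).re)) / 4 := by
    funext k
    rfl
  rw [hdata]
  exact eval_symInterp_localReading_klFermiPoint hβ _ μ K θ

/-! ## §4 The scale increment: input + one line + ≥ 2 self-lines + ≥ 2 vertices, at the continuum level -/

/-- **The continuum localised reading of `effAction C W`, split EXACTLY** (linearity): input · one line · ≥ 2 self-lines · ≥ 2 vertices. -/
theorem localReadingCont_effAction_split (β : ℝ) (C : Matrix (HubbardFieldIdx L M) (HubbardFieldIdx L M) ℂ) (W : HubbardGrassmann L M)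
    (P : Fin 2 → ℝ) :
    localReadingCont β (effAction ℂ C W) P =
      localReadingCont β W P + localReadingCont β (grassmannLaplacian ℂ C W) P +
        localReadingCont β (gaussConv ℂ C W - W - grassmannLaplacian ℂ C W) P +
          localReadingCont β (effAction ℂ C W - gaussConv ℂ C W) P := by
  rw [localReadingCont_sub, localReadingCont_sub, localReadingCont_sub]
  ring

/-- **THE SCALE INCREMENT OF THE LOCAL PART AS AN EIGHT-IMAGE AVERAGE** (`β ≠ 0`, `Z^K_{Λ_n} ≠ 0`): with `S = C^K_{(Λ_{n+1},Λ_n]}`, `R₁ = e^{Δ_S}𝒱_n − 𝒱_n − Δ_S𝒱_n`,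
`R₂ = effAction S 𝒱_n − e^{Δ_S}𝒱_n` and `𝒯 := localReadingCont(Δ_S 𝒱_n) + localReadingCont(R₁) + localReadingCont(R₂)`:
`ν_{n+1}(K)(θ) − ν_n(K)(θ) = ⅛ Σ_{θ′} Re 𝒯(k_F^K(θ′))` — LAYER 1's `klLocalPart_succ_sub_eq` with the interpolant removed. [cite: BenfattoGiulianiMastropietro2006, §2.4] -/
theorem klLocalPart_succ_sub_eq_avg8 {β : ℝ} (hβ : β ≠ 0) (U μ : ℝ) (K : TrigPolyC4v) (n : ℕ)
    (hZ : hubbardEffPartitionFnCT L M β U μ 0 K (klScale klE0 n) ≠ 0) {T : (Fin 2 → ℝ) → ℂ}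
    (hT : T = fun P =>
      localReadingCont β (grassmannLaplacian ℂ (hubbardCovSliceCT L M β μ 0 K (klScale klE0 (n + 1)) (klScale klE0 n))
          (klEffectiveAction L M β U μ K klE0 n)) P +
        localReadingCont β
          (gaussConv ℂ (hubbardCovSliceCT L M β μ 0 K (klScale klE0 (n + 1)) (klScale klE0 n)) (klEffectiveAction L M β U μ K klE0 n) -
            klEffectiveAction L M β U μ K klE0 n -
            grassmannLaplacian ℂ (hubbardCovSliceCT L M β μ 0 K (klScale klE0 (n + 1)) (klScale klE0 n))
              (klEffectiveAction L M β U μ K klE0 n)) P +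
        localReadingCont β
          (effAction ℂ (hubbardCovSliceCT L M β μ 0 K (klScale klE0 (n + 1)) (klScale klE0 n)) (klEffectiveAction L M β U μ K klE0 n) -
            gaussConv ℂ (hubbardCovSliceCT L M β μ 0 K (klScale klE0 (n + 1)) (klScale klE0 n)) (klEffectiveAction L M β U μ K klE0 n)) P)
    (θ : ℝ) :
    klLocalPart L M β U μ K (n + 1) θ - klLocalPart L M β U μ K n θ =
      ((T (klFermiPoint μ K θ)).re + (T (klFermiPoint μ K (θ + π))).re +
        ((T (klFermiPoint μ K (-θ))).re + (T (klFermiPoint μ K (-θ + π))).re) +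
        ((T (klFermiPoint μ K (π / 2 - θ))).re + (T (klFermiPoint μ K (π / 2 - θ + π))).re) +
        ((T (klFermiPoint μ K (π / 2 + θ))).re + (T (klFermiPoint μ K (π / 2 + θ + π))).re)) / 8 := by
  have hincr : ∀ P, T P = localReadingCont β (klEffectiveAction L M β U μ K klE0 (n + 1)) P -
      localReadingCont β (klEffectiveAction L M β U μ K klE0 n) P := fun P => by
    rw [hT, klEffectiveAction_succ_eq_effAction_slice β U μ K klE0 n hZ, localReadingCont_effAction_split]
    ring
  simp_rw [hincr, Complex.sub_re]
  rw [klLocalPart_eq_avg8 hβ, klLocalPart_eq_avg8 hβ]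
  ring

/-- The increment function `𝒯` of `klLocalPart_succ_sub_eq_avg8` is a canonical character polynomial (so `…C4aTadpoleRepresentation` may identify its
tadpole part with the explicit tube form by comparing LATTICE values, `IsCharPoly.eq_of_eq_latticeMomentum`). -/
theorem isCharPoly_localReadingCont_add₃ (β : ℝ) (G₁ G₂ G₃ : HubbardGrassmann L M) :
    IsCharPoly L fun P => localReadingCont β G₁ P + localReadingCont β G₂ P + localReadingCont β G₃ P :=
  ((isCharPoly_localReadingCont β G₁).add (isCharPoly_localReadingCont β G₂)).add (isCharPoly_localReadingCont β G₃)

end Model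

end Summit.HubbardSuperconductivity.HubbardSuperconductivity.Theorems.C4a

end
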